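import Literature.MathematicalPhysics.QuantumFieldTheory.Balaban1983to89.B8Eq140Level
import Literature.MathematicalPhysics.QuantumFieldTheory.Balaban1983to89.B8Ineq1144ClassAk

/-!
# `Balaban1983to89.B8Eq148Local` — [Balaban1985RegularSpaces] (1.44), (1.46), (1.48) p. 84 «on Ω_j»: the first three
# pieces of the basic estimate AT ONE BOND from hypotheses on the plaquettes through that bond only

statement-level skeleton of published theorems with citation tags; proofs where landed; nothing here is a claim about the Yang–Mills mass gap

T. Bałaban, *Spaces of regular gauge field configurations on a lattice and gauge fixing conditions*, Commun.
Math. Phys. **99** (1985) 75–102 `[Balaban1985RegularSpaces]` ("B8"; printed page = PDF page + 74).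
PDF held: `paper:balaban1985-cmp99-regular-spaces-gauge-fixing` (lit store), pp. 76–77, 84–86 and 100 read as text
(`p0002.txt`, `p0003.txt`, `p0010.txt`–`p0012.txt`, `p0026.txt`).  STATUS: published, refereed.
This file RE-DERIVES the parents' kernel certificates of (1.44) (`B8Eq143PlaqExpansion.eq144`) and (1.46)/(1.48)
(`B8Eq146AExpansion.eq146`/`eq148`) — whose smallness hypotheses are quantified over ALL bonds / plaquettes of `ℤ^d`
(their HONEST SCOPE: «All bounds are GLOBAL … where print localises to Ω_j») — with the SAME proofs but with the
hypotheses restricted to the plaquettes having the bond as a side and to the sides of those plaquettes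
(`B8Eq140Level.PlaqNear`/`BondNear`), which is what the printed argument uses («a value of this expression at a bond
⟨x, x + ηe_μ⟩ ∈ Ω_j», p. 84).  Nothing here is new mathematics and nothing here is a claim about the Clay problem.
Companions: `B8Eq154Local` ((1.51)–(1.54) local), `B8Prop7ClassAkLocal` (Sect. G for a general family).

WHAT IS REPRODUCED (lit-balaban SKELETON rows): **B8.Eq1.44**, **B8.Eq1.46**, **B8.Eq1.48** (with (1.43), (1.45),
(1.47) as used) in their printed LOCAL form.  Unit `lit-balaban-p40` (Phase-2 proof seat p40, gen 5), HOME
`run/shared/lean/pub/lit-balaban/` (owner fold `lit-balaban-r05/ROWS-B8.md`).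

## THE PRINTED TEXT (p. 84 [PDF 10], quoted from the text layer)

«The first two terms on the right-hand side can be bounded by 4α₂α₀(Lʲη)⁻³η³ for p ⊂ Ω_j. If we apply the derivative
D^{η*}_{U₁U₀} to ∂U₁U₀, then the derivative of these two terms can be bounded by 8dα₂α₀(Lʲη)⁻³η². Further we have
|D^{η*}_{U₁U₀}∂U₀ − D^{η*}_{U₀}∂U₀| < 2dα₀α₂(Lʲη)⁻³η² on Ω_j. … Thus we have
D^{η*}_{U₁U₀}∂U₁U₀ = D^{η*}_{U₀}∂U₀ + D^{η*}_{U₁U₀}∂_{U₀}U₁ + O₁(10dα₀α₂(Lʲη)⁻³η²). (1.44)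
Let us consider the second term on the right-hand side above. From the definition (1.1), (1.2) we obtain that a value
of this expression at a bond ⟨x, x + ηe_μ⟩ ∈ Ω_j is equal to … (1.45) … This gives … (1.46) …
(∂_{U₀}U₁)(p) − 1 = iη²(D^η_{U₀}A)(p) − ½η²V₂(U₀, A, ∂p) + O₁((1/3!)η³(∂|A|(p))³), (1.47) … (1.48)»

## WHAT IS CERTIFIED HERE (kernel; axioms `propext` / `Classical.choice` / `Quot.sound`)

On the `ℤ^d` carriers (complete normed `ℂ`-algebra `𝔸` with `‖1‖ = 1`, `U1 𝔸 = {|u| ≤ 1, |u⁻¹| ≤ 1}`), for the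
bond `b = ⟨x, x + e_μ⟩`:
* §1 PLAQUETTE-LOCAL forms of the parents' one-plaquette bounds, hypotheses on the four sides / the two gradient entries
  of THAT plaquette only: `norm_rem43_le_loc` ((1.43) cross terms), `taylor_covPlaqF_side` ((1.47) Taylor data,
  amplitude `4a`), `norm_lin_le_loc`, `norm_lin_le_deriv_loc`, `norm_eta_smul_covDerivFwd_le_loc`,
  `norm_eta_smul_covDeriv_le_loc`, `norm_V2_sub_brk0_le_loc` ((1.50): `|V₂ − 2[B_κ, B_ν]| ≤ 24ηaG`).
* §2 **(1.44) AT ONE BOND**: `eq144_loc` (`≤ 10(d − 1)η⁻¹up` for `|U₁ − 1| ≤ u` on the `BondNear` bonds and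
  `|U₀(∂p) − 1| ≤ p` on the `PlaqNear` plaquettes), `eq144_printed_loc` (`10dα₀α₂(Lʲη)⁻³η²`).
* §3 **(1.46)/(1.48) AT ONE BOND**: `eq146_loc` (`(d − 1)η⁻¹Φ(a)`), `eq148_loc` (`2(d − 1)η⁻¹ρ₃(4a)`) for `|B| ≤ a` on
  the `BondNear` bonds.
The structural hypotheses «`U₀`, `U₁` are `U1`-valued» stay global (a gauge field configuration is `G`-valued on all
of `T_η`).

## HONEST SCOPE — what is NOT claimed

(i) Estimates, constants and side conditions are EXACTLY the parents'; only the quantifiers of the hypotheses shrink to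
the neighbourhood the proofs use.  (ii) The transport-identity reading and the `d − 1` vs `d` count are as in the
parents (`B8Eq151V2Divergence` HONEST SCOPE (ii)).  (iii) Which bonds satisfy these local hypotheses under print's
level-wise (1.139)/(1.140) «on Ω_j» is the business of `B8Prop7ClassAkLocal` (one-layer enlarged reading,
`B8Eq140Level` HONEST SCOPE (i)).
-/

noncomputable section

open scoped BigOperators
open NormedSpace Finset

namespace Literature.MathematicalPhysics.QuantumFieldTheory.Balaban1983to89.B8Eq148Local

open B7Prop1Explicit
open B7Eq78Linearization (conjR conjR_apply conjR_one conjR_add conjR_sub conjR_smul conjR_smul_real)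
open B8Lemma1NonAbelian (mulCfg)
open B8Ineq132 (plaqF covDeriv covDerivFwd covDiv conjR_conjR one_conjR conjR_sum conjR_units norm_conjR_le
  norm_conjR)
open B8Eq143PlaqExpansion
open B8Eq146AExpansion
open B8Eq151V2Divergence
open B8Eq140Level

-- `Site` alone would resolve to the torus sites of `Setup.lean`; re-export the `ℤ^d` sites of `B7Prop1Explicit`.
export B7Prop1Explicit (Site)

variable {d : ℕ}

/-! ## §1 Plaquette-local forms of the parents' one-plaquette bounds -/

section Plaquette

variable {𝔸 : Type*} [NormedRing 𝔸] [NormOneClass 𝔸] [NormedAlgebra ℂ 𝔸] [CompleteSpace 𝔸]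

omit [NormedAlgebra ℂ 𝔸] [CompleteSpace 𝔸] in
/-- `B8Eq143PlaqExpansion.norm_rem43_le` with `|U₁ − 1| ≤ u` on the four sides of the plaquette only:
`|rem43(p_{κν}(z))| ≤ 4u|U₀(∂p) − 1|`. [cite: Balaban1985RegularSpaces, p.84 (first sentence)] -/
theorem norm_rem43_le_loc {U₀ U₁ : Site d → Fin d → 𝔸ˣ} (h₀ : ∀ y κ, U₀ y κ ∈ U1 𝔸) (h₁ : ∀ y κ, U₁ y κ ∈ U1 𝔸)
    {z : Site d} {κ ν : Fin d} {u p : ℝ} (hu : ∀ y τ, IsSide z κ ν y τ → ‖(U₁ y τ : 𝔸) - 1‖ ≤ u)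
    (hP : ‖plaqF U₀ κ ν z - 1‖ ≤ p) : ‖rem43 U₀ U₁ κ ν z‖ ≤ 4 * u * p := by
  unfold rem43
  refine norm_two_terms_le ?_ ?_ (trail_mem h₀ h₁ κ ν z).1 hP
  · refine (norm_lead_sub_one_le (h₀ z κ) (h₁ z κ) ν).trans ?_
    have := hu _ _ (isSide₁ z κ ν); have := hu _ _ (isSide₂ z κ ν); linarith
  · refine (norm_trail_sub_one_le (h₀ z ν) (h₁ _ _) (h₁ _ _)).trans ?_
    have := hu _ _ (isSide₃ z κ ν); have := hu _ _ (isSide₄ z κ ν); linarith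

/-- `B8Eq146AExpansion.taylor_covPlaqF_unif` with `|B| ≤ a` on the four sides only: the Taylor data of (1.47) with
amplitude `4a`. [cite: Balaban1985RegularSpaces, (1.47) p.84] -/
theorem taylor_covPlaqF_side {U₀ : Site d → Fin d → 𝔸ˣ} (h₀ : ∀ y κ, U₀ y κ ∈ U1 𝔸) {B : Site d → Fin d → 𝔸}
    {z : Site d} {κ ν : Fin d} {a : ℝ} (hB : ∀ y τ, IsSide z κ ν y τ → ‖B y τ‖ ≤ a) :
    T2 (covPlaqF U₀ (expCfg B) κ ν z) (lin U₀ B κ ν z) (quad U₀ B κ ν z) (4 * a) := by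
  refine (taylor_covPlaqF h₀ B κ ν z).mono ?_
  unfold bdry
  linarith [hB _ _ (isSide₁ z κ ν), hB _ _ (isSide₂ z κ ν), hB _ _ (isSide₃ z κ ν), hB _ _ (isSide₄ z κ ν)]

omit [NormedAlgebra ℂ 𝔸] [CompleteSpace 𝔸] in
/-- `B8Eq151V2Divergence.norm_lin_le` with `|B| ≤ a` on the four sides only: `|Σᵢxᵢ| ≤ 4a`.
[cite: Balaban1985RegularSpaces, (1.47) p.84] -/
theorem norm_lin_le_loc {U₀ : Site d → Fin d → 𝔸ˣ} (h₀ : ∀ y κ, U₀ y κ ∈ U1 𝔸) {B : Site d → Fin d → 𝔸}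
    {z : Site d} {κ ν : Fin d} {a : ℝ} (hB : ∀ y τ, IsSide z κ ν y τ → ‖B y τ‖ ≤ a) :
    ‖lin U₀ B κ ν z‖ ≤ 4 * a := by
  unfold lin X1 X2 X3 X4
  calc ‖B z κ + conjR (U₀ z κ) (B (z + e κ) ν) + conjR (U₀ z ν) (-B (z + e ν) κ) + -B z ν‖
      ≤ ‖B z κ‖ + ‖conjR (U₀ z κ) (B (z + e κ) ν)‖ + ‖conjR (U₀ z ν) (-B (z + e ν) κ)‖ + ‖-B z ν‖ :=
        (norm_add_le _ _).trans (add_le_add norm_add₃_le le_rfl)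
    _ ≤ a + a + a + a := by
        gcongr
        · exact hB _ _ (isSide₁ z κ ν)
        · exact (norm_conjR_le (h₀ z κ) _).trans (hB _ _ (isSide₂ z κ ν))
        · exact (norm_conjR_le (h₀ z ν) _).trans ((norm_neg _).trans_le (hB _ _ (isSide₃ z κ ν)))
        · exact (norm_neg _).trans_le (hB _ _ (isSide₄ z κ ν))
    _ = 4 * a := by ring

omit [NormOneClass 𝔸] [CompleteSpace 𝔸] in
/-- `B8Eq151V2Divergence.norm_lin_le_deriv` with the two gradient entries of the plaquette only:
`|Σᵢxᵢ| = η|(D_κB_ν)(z) − (D_νB_κ)(z)| ≤ 2ηG`. [cite: Balaban1985RegularSpaces, p.85; Balaban1985BackgroundPropagators, (3.4) p.391] -/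
theorem norm_lin_le_deriv_loc {η : ℝ} (hη : 0 < η) {U₀ : Site d → Fin d → 𝔸ˣ} {B : Site d → Fin d → 𝔸}
    {z : Site d} {κ ν : Fin d} {G : ℝ} (hG₁ : ‖covDerivFwd η U₀ κ (fun w => B w ν) z‖ ≤ G)
    (hG₂ : ‖covDerivFwd η U₀ ν (fun w => B w κ) z‖ ≤ G) : ‖lin U₀ B κ ν z‖ ≤ 2 * η * G := by
  rw [lin_eq_smul_plaqCovDeriv hη.ne', plaqCovDeriv_eq_covDerivFwd, norm_smul, Real.norm_of_nonneg hη.le]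
  calc η * ‖covDerivFwd η U₀ κ (fun y => B y ν) z - covDerivFwd η U₀ ν (fun y => B y κ) z‖ ≤ η * (G + G) :=
        mul_le_mul_of_nonneg_left ((norm_sub_le _ _).trans (add_le_add hG₁ hG₂)) hη.le
    _ = 2 * η * G := by ring

omit [CompleteSpace 𝔸] in
/-- `|η(D_κB_τ)(y)| = |R(U₀(y, y + e_κ))B_τ(y + e_κ) − B_τ(y)| ≤ 2a` from the two bond values only.
[cite: Balaban1985RegularSpaces, (1.1) p.76] -/
theorem norm_eta_smul_covDerivFwd_le_loc {η : ℝ} (hη : η ≠ 0) {U₀ : Site d → Fin d → 𝔸ˣ}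
    (h₀ : ∀ y κ, U₀ y κ ∈ U1 𝔸) {B : Site d → Fin d → 𝔸} {a : ℝ} {y : Site d} {κ τ : Fin d}
    (hB₁ : ‖B (y + e κ) τ‖ ≤ a) (hB₂ : ‖B y τ‖ ≤ a) : ‖η • covDerivFwd η U₀ κ (fun z => B z τ) y‖ ≤ 2 * a := by
  rw [eta_smul_covDerivFwd hη]
  calc _ ≤ ‖conjR (U₀ y κ) (B (y + e κ) τ)‖ + ‖B y τ‖ := norm_sub_le _ _
    _ ≤ a + a := add_le_add ((norm_conjR_le (h₀ y κ) _).trans hB₁) hB₂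
    _ = 2 * a := by ring

omit [CompleteSpace 𝔸] in
/-- `|η(D*_νB_τ)(x)| = |R(U₀(x, x − e_ν))B_τ(x − e_ν) − B_τ(x)| ≤ 2a` from the two bond values only.
[cite: Balaban1985RegularSpaces, (1.1) p.76] -/
theorem norm_eta_smul_covDeriv_le_loc {η : ℝ} (hη : η ≠ 0) {U₀ : Site d → Fin d → 𝔸ˣ}
    (h₀ : ∀ y κ, U₀ y κ ∈ U1 𝔸) {B : Site d → Fin d → 𝔸} {a : ℝ} {x : Site d} {ν τ : Fin d}
    (hB₁ : ‖B (x - e ν) τ‖ ≤ a) (hB₂ : ‖B x τ‖ ≤ a) : ‖η • covDeriv η U₀ ν (fun z => B z τ) x‖ ≤ 2 * a := by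
  rw [eta_smul_covDeriv hη]
  calc _ ≤ ‖conjR (U₀ (x - e ν) ν)⁻¹ (B (x - e ν) τ)‖ + ‖B x τ‖ := norm_sub_le _ _
    _ ≤ a + a := add_le_add ((norm_conjR_le ((U1 𝔸).inv_mem (h₀ _ _)) _).trans hB₁) hB₂
    _ = 2 * a := by ring

omit [CompleteSpace 𝔸] in
/-- `B8Eq151V2Divergence.norm_V2_sub_brk0_le` with `|B| ≤ a` on the four sides and `|∇B| ≤ G` at the two gradient
entries of the plaquette only: `|V₂(U₀, B, ∂p_{κν}(z)) − 2[B_κ(z), B_ν(z)]| ≤ 24η·a·G` ((1.50)).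
[cite: Balaban1985RegularSpaces, (1.50)-(1.51) p.85] -/
theorem norm_V2_sub_brk0_le_loc {η : ℝ} (hη : 0 < η) {U₀ : Site d → Fin d → 𝔸ˣ} (h₀ : ∀ y κ, U₀ y κ ∈ U1 𝔸)
    {B : Site d → Fin d → 𝔸} {a G : ℝ} {z : Site d} {κ ν : Fin d}
    (hB : ∀ y τ, IsSide z κ ν y τ → ‖B y τ‖ ≤ a) (hG₁ : ‖covDerivFwd η U₀ κ (fun w => B w ν) z‖ ≤ G)
    (hG₂ : ‖covDerivFwd η U₀ ν (fun w => B w κ) z‖ ≤ G) :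
    ‖V2 U₀ B κ ν z - brk0 B κ ν z‖ ≤ 24 * η * a * G := by
  rw [V2_eq_sq_add_brk, eq150 hη.ne', brk0_apply]
  set P' := covDerivFwd η U₀ κ (fun y => B y ν) z with hP'def
  set Q' := covDerivFwd η U₀ ν (fun y => B y κ) z with hQ'def
  have ha0 : 0 ≤ a := (norm_nonneg _).trans (hB _ _ (isSide₁ z κ ν))
  have hG0 : 0 ≤ G := (norm_nonneg _).trans hG₁
  have ha := hB _ _ (isSide₁ z κ ν)
  have hb := hB _ _ (isSide₄ z κ ν)
  have hP : ‖P'‖ ≤ G := hG₁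
  have hQ : ‖Q'‖ ≤ G := hG₂
  have hηP : ‖η • P'‖ ≤ 2 * a := norm_eta_smul_covDerivFwd_le_loc hη.ne' h₀ (hB _ _ (isSide₂ z κ ν)) hb
  have hsn : ∀ Z : 𝔸, ‖η • Z‖ = η * ‖Z‖ := fun Z => by rw [norm_smul, Real.norm_of_nonneg hη.le]
  have t1 : ‖lin U₀ B κ ν z * lin U₀ B κ ν z‖ ≤ 4 * a * (2 * η * G) :=
    (norm_mul_le _ _).trans
      (mul_le_mul (norm_lin_le_loc h₀ hB) (norm_lin_le_deriv_loc hη hG₁ hG₂) (norm_nonneg _) (by positivity))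
  have t2 : ‖2 * (η • adR (B z κ) P')‖ ≤ 2 * (η * (2 * a * G)) := by
    refine (norm_two_mul_le _).trans (mul_le_mul_of_nonneg_left ?_ zero_le_two)
    rw [hsn]
    exact mul_le_mul_of_nonneg_left (norm_adR_le_of_le ha hP) hη.le
  have t3 : ‖2 * (η • adR Q' (B z ν))‖ ≤ 2 * (η * (2 * G * a)) := by
    refine (norm_two_mul_le _).trans (mul_le_mul_of_nonneg_left ?_ zero_le_two)
    rw [hsn]
    exact mul_le_mul_of_nonneg_left (norm_adR_le_of_le hQ hb) hη.le
  have t4 : ‖η • adR (B z κ) Q'‖ ≤ η * (2 * a * G) := by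
    rw [hsn]
    exact mul_le_mul_of_nonneg_left (norm_adR_le_of_le ha hQ) hη.le
  have t5 : ‖η • adR P' (B z ν)‖ ≤ η * (2 * G * a) := by
    rw [hsn]
    exact mul_le_mul_of_nonneg_left (norm_adR_le_of_le hP hb) hη.le
  have t6 : ‖η ^ 2 • adR P' Q'‖ ≤ η * (2 * (2 * a) * G) := by
    rw [sq, ← smul_smul, ← adR_smul_left_real η P' Q', hsn]
    exact mul_le_mul_of_nonneg_left (norm_adR_le_of_le hηP hQ) hη.le
  have heq : lin U₀ B κ ν z * lin U₀ B κ ν z +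
      (2 * adR (B z κ) (B z ν) + 2 * (η • adR (B z κ) P') + 2 * (η • adR Q' (B z ν)) - η • adR (B z κ) Q'
        - η • adR P' (B z ν) - η ^ 2 • adR P' Q') - 2 * adR (B z κ) (B z ν) =
      lin U₀ B κ ν z * lin U₀ B κ ν z + 2 * (η • adR (B z κ) P') + 2 * (η • adR Q' (B z ν))
        - η • adR (B z κ) Q' - η • adR P' (B z ν) - η ^ 2 • adR P' Q' := by abel
  rw [heq]
  refine (norm_six_le _ _ _ _ _ _).trans ?_
  nlinarith [t1, t2, t3, t4, t5, t6]

end Plaquette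

/-! ## §2 (1.44) at one bond -/

section Eq144

variable {𝔸 : Type*} [NormedRing 𝔸] [NormOneClass 𝔸] [NormedAlgebra ℂ 𝔸]

/-- «the derivative of these two terms can be bounded by 8dα₂α₀(Lʲη)⁻³η²» AT ONE BOND:
`|(D^{η*}_{U₁U₀} rem43)_μ(x)| ≤ 8(d − 1)η⁻¹up` for `|U₁ − 1| ≤ u` on the `BondNear` bonds and `|U₀(∂p) − 1| ≤ p` on
the `PlaqNear` plaquettes of `⟨x, x + e_μ⟩`. [cite: Balaban1985RegularSpaces, p.84 (second sentence)] -/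
theorem norm_pdiv_rem43_le_loc {η : ℝ} (hη : 0 < η) {U₀ U₁ : Site d → Fin d → 𝔸ˣ}
    (h₀ : ∀ y κ, U₀ y κ ∈ U1 𝔸) (h₁ : ∀ y κ, U₁ y κ ∈ U1 𝔸) {u p : ℝ} {μ : Fin d} {x : Site d}
    (hu : ∀ y τ, BondNear μ x y τ → ‖(U₁ y τ : 𝔸) - 1‖ ≤ u)
    (hp : ∀ y κ ν, PlaqNear μ x y κ ν → ‖plaqF U₀ κ ν y - 1‖ ≤ p) :
    ‖pdiv η (mulCfg U₁ U₀) (rem43 U₀ U₁) μ x‖ ≤ 8 * ((d : ℝ) - 1) * η⁻¹ * u * p := by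
  have hR : ∀ y κ ν, PlaqNear μ x y κ ν → ‖rem43 U₀ U₁ κ ν y‖ ≤ 4 * u * p := fun y κ ν hq =>
    norm_rem43_le_loc h₀ h₁ (fun w σ hs => hu w σ (bondNear_of hq hs)) (hp y κ ν hq)
  unfold pdiv
  calc _ ≤ ((d : ℝ) - 1) * (η⁻¹ * (4 * u * p + 4 * u * p)) := by
        refine norm_sub_sums_le (fun ν hν => ?_) (fun ν hν => ?_)
        · have hne : ν ≠ μ := (Finset.mem_Iio.mp hν).ne
          have hW : mulCfg U₁ U₀ (x - e ν) ν ∈ U1 𝔸 := mulCfg_mem h₀ h₁ (x - e ν) ν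
          exact (norm_covDeriv_le hη hW (rem43 U₀ U₁ ν μ)).trans
            (mul_le_mul_of_nonneg_left (add_le_add (hR _ _ _ (plaqNear₃ hne)) (hR _ _ _ (plaqNear₁ hne)))
              (inv_nonneg.mpr hη.le))
        · have hne : ν ≠ μ := (Finset.mem_Ioi.mp hν).ne'
          have hW : mulCfg U₁ U₀ (x - e ν) ν ∈ U1 𝔸 := mulCfg_mem h₀ h₁ (x - e ν) ν
          exact (norm_covDeriv_le hη hW (rem43 U₀ U₁ μ ν)).trans
            (mul_le_mul_of_nonneg_left (add_le_add (hR _ _ _ (plaqNear₄ hne)) (hR _ _ _ (plaqNear₂ hne)))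
              (inv_nonneg.mpr hη.le))
    _ = 8 * ((d : ℝ) - 1) * η⁻¹ * u * p := by ring

/-- «|D^{η*}_{U₁U₀}∂U₀ − D^{η*}_{U₀}∂U₀| < 2dα₀α₂(Lʲη)⁻³η² on Ω_j» AT ONE BOND: `≤ 2(d − 1)η⁻¹up` under the same local
hypotheses. [cite: Balaban1985RegularSpaces, p.84 (third sentence)] -/
theorem norm_pdiv_plaqF_sub_covDiv_le_loc {η : ℝ} (hη : 0 < η) {U₀ U₁ : Site d → Fin d → 𝔸ˣ}
    (h₀ : ∀ y κ, U₀ y κ ∈ U1 𝔸) (h₁ : ∀ y κ, U₁ y κ ∈ U1 𝔸) {u p : ℝ} {μ : Fin d} {x : Site d}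
    (hu : ∀ y τ, BondNear μ x y τ → ‖(U₁ y τ : 𝔸) - 1‖ ≤ u)
    (hp : ∀ y κ ν, PlaqNear μ x y κ ν → ‖plaqF U₀ κ ν y - 1‖ ≤ p) :
    ‖pdiv η (mulCfg U₁ U₀) (plaqF U₀) μ x - covDiv η U₀ μ x‖ ≤ 2 * ((d : ℝ) - 1) * η⁻¹ * u * p := by
  rw [pdiv_plaqF_sub_covDiv]
  have step : ∀ ν : Fin d, ν ≠ μ → ∀ κ κ' : Fin d, PlaqNear μ x (x - e ν) κ κ' →
      ‖corr η U₀ U₁ ν (plaqF U₀ κ κ') x‖ ≤ η⁻¹ * (2 * u * p) := by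
    intro ν hne κ κ' hq
    have hux : ‖(U₁ (x - e ν) ν : 𝔸) - 1‖ ≤ u := hu _ _ (bondNear_of (plaqNear₃ hne) (isSide₁ _ _ _))
    have hu0 : 0 ≤ u := (norm_nonneg _).trans hux
    refine (norm_corr_le hη (h₀ (x - e ν) ν) (h₁ (x - e ν) ν) (plaqF U₀ κ κ')).trans
      (mul_le_mul_of_nonneg_left ?_ (inv_nonneg.mpr hη.le))
    exact mul_le_mul (mul_le_mul_of_nonneg_left hux zero_le_two) (hp _ _ _ hq) (norm_nonneg _)
      (mul_nonneg zero_le_two hu0)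
  calc _ ≤ ((d : ℝ) - 1) * (η⁻¹ * (2 * u * p)) :=
        norm_sub_sums_le
          (fun ν hν => step ν (Finset.mem_Iio.mp hν).ne ν μ (plaqNear₃ (Finset.mem_Iio.mp hν).ne))
          (fun ν hν => step ν (Finset.mem_Ioi.mp hν).ne' μ ν (plaqNear₄ (Finset.mem_Ioi.mp hν).ne'))
    _ = 2 * ((d : ℝ) - 1) * η⁻¹ * u * p := by ring

/-- **(1.44) AT ONE BOND**: `|D^{η*}_{U₁U₀}∂(U₁U₀)_μ(x) − D^{η*}_{U₀}∂U₀,_μ(x) − D^{η*}_{U₁U₀}(∂_{U₀}U₁)_μ(x)| ≤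
10(d − 1)η⁻¹up` for `U1`-valued `U₀, U₁` with `|U₁ − 1| ≤ u` on the `BondNear` bonds and `|U₀(∂p) − 1| ≤ p` on the
`PlaqNear` plaquettes of `⟨x, x + e_μ⟩`. [cite: Balaban1985RegularSpaces, (1.44) p.84] -/
theorem eq144_loc {η : ℝ} (hη : 0 < η) {U₀ U₁ : Site d → Fin d → 𝔸ˣ} (h₀ : ∀ y κ, U₀ y κ ∈ U1 𝔸)
    (h₁ : ∀ y κ, U₁ y κ ∈ U1 𝔸) {u p : ℝ} {μ : Fin d} {x : Site d}
    (hu : ∀ y τ, BondNear μ x y τ → ‖(U₁ y τ : 𝔸) - 1‖ ≤ u)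
    (hp : ∀ y κ ν, PlaqNear μ x y κ ν → ‖plaqF U₀ κ ν y - 1‖ ≤ p) :
    ‖covDiv η (mulCfg U₁ U₀) μ x - covDiv η U₀ μ x - pdiv η (mulCfg U₁ U₀) (covPlaqF U₀ U₁) μ x‖ ≤
      10 * ((d : ℝ) - 1) * η⁻¹ * u * p := by
  rw [eq144_identity]
  calc _ ≤ ‖pdiv η (mulCfg U₁ U₀) (rem43 U₀ U₁) μ x‖ +
        ‖pdiv η (mulCfg U₁ U₀) (plaqF U₀) μ x - covDiv η U₀ μ x‖ := norm_add_le _ _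
    _ ≤ 8 * ((d : ℝ) - 1) * η⁻¹ * u * p + 2 * ((d : ℝ) - 1) * η⁻¹ * u * p :=
        add_le_add (norm_pdiv_rem43_le_loc hη h₀ h₁ hu hp) (norm_pdiv_plaqF_sub_covDiv_le_loc hη h₀ h₁ hu hp)
    _ = 10 * ((d : ℝ) - 1) * η⁻¹ * u * p := by ring

/-- **(1.44) AT ONE BOND in print's units**: `O₁(10dα₀α₂(Lʲη)⁻³η²)` for `|U₁ − 1| ≤ α₂(Lʲη)⁻¹η` on the `BondNear` bonds
and `|U₀(∂p) − 1| ≤ α₀η²(Lʲη)⁻²` on the `PlaqNear` plaquettes. [cite: Balaban1985RegularSpaces, (1.44) p.84] -/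
theorem eq144_printed_loc {η : ℝ} (hη : 0 < η) {U₀ U₁ : Site d → Fin d → 𝔸ˣ} (h₀ : ∀ y κ, U₀ y κ ∈ U1 𝔸)
    (h₁ : ∀ y κ, U₁ y κ ∈ U1 𝔸) {L j : ℕ} {α₀ α₂ : ℝ} (hα₀ : 0 ≤ α₀) (hα₂ : 0 ≤ α₂) {μ : Fin d} {x : Site d}
    (hu : ∀ y τ, BondNear μ x y τ → ‖(U₁ y τ : 𝔸) - 1‖ ≤ α₂ * ((L : ℝ) ^ j * η)⁻¹ * η)
    (hp : ∀ y κ ν, PlaqNear μ x y κ ν → ‖plaqF U₀ κ ν y - 1‖ ≤ α₀ * η ^ 2 * (((L : ℝ) ^ j * η)⁻¹) ^ 2) :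
    ‖covDiv η (mulCfg U₁ U₀) μ x - covDiv η U₀ μ x - pdiv η (mulCfg U₁ U₀) (covPlaqF U₀ U₁) μ x‖ ≤
      10 * d * α₀ * α₂ * (((L : ℝ) ^ j * η)⁻¹) ^ 3 * η ^ 2 :=
  (eq144_loc hη h₀ h₁ hu hp).trans (units_p84 (by norm_num) hη (inv_nonneg.mpr (by positivity)) hα₀ hα₂ d)

end Eq144

/-! ## §3 (1.46) and (1.48) at one bond -/

section Eq146

variable {𝔸 : Type*} [NormedRing 𝔸] [NormedAlgebra ℂ 𝔸] [CompleteSpace 𝔸] [NormOneClass 𝔸]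

/-- **(1.46) AT ONE BOND** (sharp form): for `U1`-valued `U₀`, `U₁ = e^B` with `|B_b| ≤ a` on the `BondNear` bonds of
`⟨x, x + e_μ⟩`, `η > 0`:
`|(D^{η*}_{U₁U₀}∂_{U₀}U₁)(x, x + e_μ) − (D^{η*}_{U₀}(∂_{U₀}U₁ − 1))(x, x + e_μ) − main146| ≤ (d − 1)η⁻¹Φ(a)`.
[cite: Balaban1985RegularSpaces, (1.46) p.84] -/
theorem eq146_loc {η : ℝ} (hη : 0 < η) {U₀ : Site d → Fin d → 𝔸ˣ} (h₀ : ∀ y κ, U₀ y κ ∈ U1 𝔸)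
    {B : Site d → Fin d → 𝔸} {a : ℝ} {μ : Fin d} {x : Site d} (hB : ∀ y τ, BondNear μ x y τ → ‖B y τ‖ ≤ a) :
    ‖pdiv η (mulCfg (expCfg B) U₀) (covPlaqF U₀ (expCfg B)) μ x -
        pdiv η U₀ (covPlaqF U₀ (expCfg B) - 1) μ x - main146 η U₀ B μ x‖ ≤
      ((d : ℝ) - 1) * (η⁻¹ * phi146 a) := by
  set U₁ := expCfg B
  set F := covPlaqF U₀ U₁
  -- the per-direction bound, for any plaquette function with the Taylor data of (1.47)
  have key : ∀ (ν : Fin d), ν ≠ μ → ∀ (G : Site d → 𝔸) (L : 𝔸), ‖G (x - e ν) - 1‖ ≤ Real.exp (4 * a) - 1 →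
      ‖G (x - e ν) - 1 - L‖ ≤ expRem (4 * a) →
      ‖corr η U₀ U₁ ν G x - η⁻¹ • conjR (U₀ (x - e ν) ν)⁻¹ (L * B (x - e ν) ν - B (x - e ν) ν * L)‖ ≤
        η⁻¹ * phi146 a := by
    intro ν hne G L hG0 hG1
    have hbx : ‖B (x - e ν) ν‖ ≤ a := hB _ _ (bondNear_of (plaqNear₃ hne) (isSide₁ _ _ _))
    have ha : 0 ≤ a := (norm_nonneg _).trans hbx
    refine (norm_corr_sub_main_le hη (h₀ _ _) B hbx G L).trans ?_
    refine mul_le_mul_of_nonneg_left ?_ (inv_nonneg.mpr hη.le)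
    have n1 := expRem_nonneg (2 * a)
    have n2 := hbx
    unfold phi146
    gcongr
  -- the main summands, written with the first-order proxies of the neighbouring plaquettes
  set m : Fin d → 𝔸 := fun ν =>
    η⁻¹ • conjR (U₀ (x - e ν) ν)⁻¹ (adR (B (x - e ν) ν) (lin U₀ B μ ν (x - e ν)))
  have hm1 : ∀ ν, m ν = η⁻¹ • conjR (U₀ (x - e ν) ν)⁻¹
      (lin U₀ B ν μ (x - e ν) * B (x - e ν) ν - B (x - e ν) ν * lin U₀ B ν μ (x - e ν)) := by
    intro ν
    simp only [m, adR, lin_swap U₀ B μ ν, neg_mul, mul_neg, sub_neg_eq_add]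
    congr 2
    abel
  have hm2 : ∀ ν, -m ν = η⁻¹ • conjR (U₀ (x - e ν) ν)⁻¹
      (lin U₀ B μ ν (x - e ν) * B (x - e ν) ν - B (x - e ν) ν * lin U₀ B μ ν (x - e ν)) := by
    intro ν
    simp only [m, adR, ← smul_neg, ← conjR_neg, neg_sub]
  rw [eq145_covPlaq, add_sub_cancel_left, main146, sum_erase_eq_Iio_add_Ioi]
  have heq : ∑ ν ∈ Finset.Iio μ, corr η U₀ U₁ ν (F ν μ) x - ∑ ν ∈ Finset.Ioi μ, corr η U₀ U₁ ν (F μ ν) x -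
      (∑ ν ∈ Finset.Iio μ, m ν + ∑ ν ∈ Finset.Ioi μ, m ν) =
      ∑ ν ∈ Finset.Iio μ, (corr η U₀ U₁ ν (F ν μ) x - m ν) -
        ∑ ν ∈ Finset.Ioi μ, (corr η U₀ U₁ ν (F μ ν) x - -m ν) := by
    simp only [Finset.sum_sub_distrib, Finset.sum_neg_distrib]
    abel
  rw [heq]
  refine norm_sub_sums_le (fun ν hν => ?_) (fun ν hν => ?_)
  · have hne : ν ≠ μ := (Finset.mem_Iio.mp hν).ne
    have hT := taylor_covPlaqF_side (z := x - e ν) (κ := ν) (ν := μ) h₀ (B := B)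
      (fun w σ hs => hB w σ (bondNear_of (plaqNear₃ hne) hs))
    rw [hm1]
    exact key ν hne (F ν μ) _ hT.ord0 hT.ord1
  · have hne : ν ≠ μ := (Finset.mem_Ioi.mp hν).ne'
    have hT := taylor_covPlaqF_side (z := x - e ν) (κ := μ) (ν := ν) h₀ (B := B)
      (fun w σ hs => hB w σ (bondNear_of (plaqNear₄ hne) hs))
    rw [hm2]
    exact key ν hne (F μ ν) _ hT.ord0 hT.ord1

/-- **(1.48) AT ONE BOND** (sharp form): for `U1`-valued `U₀`, `U₁ = e^B`, `|B_b| ≤ a` on the `BondNear` bonds of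
`⟨x, x + e_μ⟩`, `η > 0`:
`|D^{η*}_{U₀}(∂_{U₀}U₁ − 1)_μ(x) − D^{η*}_{U₀}(Σᵢxᵢ)_μ(x) − D^{η*}_{U₀}(½Σxᵢ² + Σ_{i<j}xᵢxⱼ)_μ(x)| ≤ 2(d − 1)η⁻¹ρ₃(4a)`.
[cite: Balaban1985RegularSpaces, (1.48) p.84] -/
theorem eq148_loc {η : ℝ} (hη : 0 < η) {U₀ : Site d → Fin d → 𝔸ˣ} (h₀ : ∀ y κ, U₀ y κ ∈ U1 𝔸)
    {B : Site d → Fin d → 𝔸} {a : ℝ} {μ : Fin d} {x : Site d} (hB : ∀ y τ, BondNear μ x y τ → ‖B y τ‖ ≤ a) :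
    ‖pdiv η U₀ (covPlaqF U₀ (expCfg B) - 1) μ x - pdiv η U₀ (lin U₀ B) μ x - pdiv η U₀ (quad U₀ B) μ x‖ ≤
      2 * ((d : ℝ) - 1) * η⁻¹ * expRem3 (4 * a) := by
  set R : Fin d → Fin d → Site d → 𝔸 := covPlaqF U₀ (expCfg B) - 1 - lin U₀ B - quad U₀ B with hR
  have hsplit : covPlaqF U₀ (expCfg B) - 1 = R + lin U₀ B + quad U₀ B := by simp only [hR]; abel
  have heq : pdiv η U₀ (covPlaqF U₀ (expCfg B) - 1) μ x - pdiv η U₀ (lin U₀ B) μ x - pdiv η U₀ (quad U₀ B) μ x =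
      pdiv η U₀ R μ x := by
    rw [hsplit, pdiv_add, pdiv_add]; abel
  have hRb : ∀ κ ν y, PlaqNear μ x y κ ν → ‖R κ ν y‖ ≤ expRem3 (4 * a) := fun κ ν y hq => by
    simp only [hR, Pi.sub_apply, Pi.one_apply]
    exact (taylor_covPlaqF_side h₀ (fun w σ hs => hB w σ (bondNear_of hq hs))).ord2
  rw [heq]
  unfold pdiv
  calc _ ≤ ((d : ℝ) - 1) * (η⁻¹ * (expRem3 (4 * a) + expRem3 (4 * a))) := by
        refine norm_sub_sums_le (fun ν hν => ?_) (fun ν hν => ?_)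
        · have hne : ν ≠ μ := (Finset.mem_Iio.mp hν).ne
          exact (norm_covDeriv_le hη (h₀ _ _) _).trans
            (mul_le_mul_of_nonneg_left (add_le_add (hRb _ _ _ (plaqNear₃ hne)) (hRb _ _ _ (plaqNear₁ hne)))
              (inv_nonneg.mpr hη.le))
        · have hne : ν ≠ μ := (Finset.mem_Ioi.mp hν).ne'
          exact (norm_covDeriv_le hη (h₀ _ _) _).trans
            (mul_le_mul_of_nonneg_left (add_le_add (hRb _ _ _ (plaqNear₄ hne)) (hRb _ _ _ (plaqNear₂ hne)))
              (inv_nonneg.mpr hη.le))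
    _ = 2 * ((d : ℝ) - 1) * η⁻¹ * expRem3 (4 * a) := by ring

end Eq146

#print axioms norm_V2_sub_brk0_le_loc
#print axioms eq144_loc
#print axioms eq144_printed_loc
#print axioms eq146_loc
#print axioms eq148_loc

end Literature.MathematicalPhysics.QuantumFieldTheory.Balaban1983to89.B8Eq148Local

end
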